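import Mathlib.LinearAlgebra.Matrix.NonsingularInverse
import Mathlib.LinearAlgebra.Matrix.Adjugate
import Mathlib.LinearAlgebra.Dual.Lemmas
import Mathlib.LinearAlgebra.FiniteDimensional.Lemmas
import Mathlib.RingTheory.Localization.Module
import Mathlib.RingTheory.DedekindDomain.FiniteAdeleRing
import Literature.NumberTheory.DiophantineGeometry.SUnitTheorem
import HarnessLib

/-!
# Radicals of a finitely generated subgroup of a number field have bounded denominators

Arithmetic input for the Kummer genericity of division sequences (Bays–Kirby 2018, Prop. 3.22;
Zilber 2006 / Bays–Zilber 2011, Prop. 2.5, case of a number field): if `v₁, …, v_t ∈ kˣ` (`k` a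
number field) are multiplicatively independent modulo roots of unity, there is `m ≥ 1` such that
every relation `gᴺ = ζ ∏ vₗ^{eₗ}` (`g ∈ kˣ`, `ζ` a root of unity) forces `N ∣ m eₗ` for all `l` — the
radicals of `⟨v⟩ μ(k)` inside `k` have denominators dividing `m` (equivalently, the pure hull of
`⟨v⟩` in the free group `kˣ/μ(k)` is finitely generated). Proof: `g` and the `vₗ` are `S`-units for
the finite set `S` of primes in the support of the `vₗ`; by Dirichlet's `S`-unit theorem
(`Literature/NumberTheory/DiophantineGeometry/SUnitTheorem.lean`) the `S`-units modulo torsion form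
a lattice `ℤ^ρ`, in which the relation reads `N · g = ∑ eₗ wₗ` with `w₁, …, w_t` linearly
independent integer vectors; a non-vanishing `t × t` minor `M` of `(wₗ)` gives
`det(M) e = adj(Mᵀ) (N g|) ∈ N ℤᵗ`.

* `Literature.FieldTheory.Kummer.RadicalLattice.exists_dvd_of_linearIndependent` — the lattice lemma;
* `Literature.FieldTheory.Kummer.RadicalLattice.exists_dvd_of_pow_eq_prod_zpow` — the number-field
  statement.

## References

* M. Bays, B. Zilber, *Covers of multiplicative groups of algebraically closed fields of arbitrary
  characteristic*, Bull. LMS 43 (2011), Prop. 2.5 (first case) and Lemma 5.1.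
* B. Zilber, *Covers of the multiplicative group of an algebraically closed field of
  characteristic zero*, J. LMS 74 (2006), §2.
-/

noncomputable section

open IsDedekindDomain IsDedekindDomain.HeightOneSpectrum NumberField

namespace Literature.FieldTheory.Kummer

namespace RadicalLattice

/-! ### The lattice lemma -/

/-- **Lattice lemma.** If `w₁, …, w_t ∈ ℤ^ι` are linearly independent, there is `m ≥ 1` such that
`N c = ∑ eₗ wₗ` (`c ∈ ℤ^ι`, `e ∈ ℤᵗ`, `N ∈ ℤ`) implies `N ∣ m eₗ` for all `l` (a non-zero `t × t`
minor and the adjugate). [folklore] -/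
theorem exists_dvd_of_linearIndependent {ι : Type*} [Fintype ι] [DecidableEq ι] {t : ℕ}
    (w : Fin t → ι → ℤ) (hw : LinearIndependent ℤ w) :
    ∃ m : ℕ, 0 < m ∧ ∀ (N : ℤ) (c : ι → ℤ) (e : Fin t → ℤ),
      N • c = ∑ l, e l • w l → ∀ l, N ∣ m * e l := by
  classical
  -- rational versions of the vectors
  set wQ : Fin t → ι → ℚ := fun l i => (w l i : ℚ) with hwQ
  have hcast : wQ = (fun f : ι → ℤ => fun i => (f i : ℚ)) ∘ w := rfl
  -- `ℤ`-independence of the casts, then `ℚ`-independence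
  have hwQZ : LinearIndependent ℤ wQ := by
    let φ : (ι → ℤ) →ₗ[ℤ] (ι → ℚ) :=
      { toFun := fun f i => (f i : ℚ)
        map_add' := fun f g => by funext i; simp
        map_smul' := fun a f => by funext i; simp }
    have hφ : LinearMap.ker φ = ⊥ := by
      rw [LinearMap.ker_eq_bot']
      intro f hf
      funext i
      have := congrFun hf i
      simpa [φ] using this
    have := hw.map' φ hφ
    exact this
  have hwQi : LinearIndependent ℚ wQ := (LinearIndependent.iff_fractionRing ℤ ℚ).1 hwQZ
  -- the columns `col i = (wₗ i)ₗ ∈ ℚᵗ` span `ℚᵗ`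
  set col : ι → Fin t → ℚ := fun i l => wQ l i with hcol
  have hspan : Submodule.span ℚ (Set.range col) = ⊤ := by
    by_contra hne
    have hlt : Submodule.span ℚ (Set.range col) < ⊤ := lt_top_iff_ne_top.2 hne
    obtain ⟨f, hf0, hf⟩ := Submodule.exists_dual_map_eq_bot_of_lt_top hlt inferInstance
    have hfv : ∀ i, f (col i) = 0 := fun i => by
      have : f (col i) ∈ (Submodule.span ℚ (Set.range col)).map f :=
        Submodule.mem_map_of_mem (Submodule.subset_span ⟨i, rfl⟩)
      rw [hf] at this
      exact (Submodule.mem_bot ℚ).1 this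
    set a : Fin t → ℚ := fun l => f (Pi.single l 1) with ha
    have hfx : ∀ x : Fin t → ℚ, f x = ∑ l, x l * a l := fun x => by
      rw [LinearMap.pi_apply_eq_sum_univ f x]
      refine Finset.sum_congr rfl fun l _ => ?_
      rw [smul_eq_mul]
      congr 2
      funext j
      simp [Pi.single_apply, eq_comm]
    -- `∑ aₗ wQₗ = 0`
    have hrel : ∑ l, a l • wQ l = 0 := by
      funext i
      rw [Finset.sum_apply, Pi.zero_apply]
      have := hfv i
      rw [hfx] at this
      simpa [hcol, smul_eq_mul, mul_comm] using this
    have ha0 : ∀ l, a l = 0 := fun l =>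
      (Fintype.linearIndependent_iff.1 hwQi) a hrel l
    apply hf0
    refine LinearMap.ext fun x => ?_
    rw [hfx x]
    simp [ha0]
  -- a basis of `ℚᵗ` among the columns
  obtain ⟨b, hbsub, hbspan, hbli⟩ := exists_linearIndependent ℚ (Set.range col)
  rw [hspan] at hbspan
  have hbfin : b.Finite := hbli.setFinite
  haveI : Fintype b := hbfin.fintype
  have hcard : Fintype.card b = t := by
    have h1 := linearIndependent_iff_card_eq_finrank_span.1 hbli
    rw [Set.finrank, Subtype.range_coe_subtype, Set.setOf_mem_eq, hbspan, finrank_top,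
      Module.finrank_fintype_fun_eq_card, Fintype.card_fin] at h1
    exact h1
  let eqv : b ≃ Fin t := Fintype.equivFinOfCardEq hcard
  have hidx : ∀ x : b, ∃ i : ι, col i = x := fun x => hbsub x.2
  choose idx hidx using hidx
  -- the integer matrix `M l j = w l (idx j)`; its cast has independent columns
  set M : Matrix (Fin t) (Fin t) ℤ := fun l j => w l (idx (eqv.symm j)) with hM
  have hMQ : (M.map (Int.cast : ℤ → ℚ)).transpose = fun j => ((eqv.symm j : b) : Fin t → ℚ) := by
    funext j l
    rw [Matrix.transpose_apply, Matrix.map_apply, ← hidx (eqv.symm j)]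
  have hli : LinearIndependent ℚ (M.map (Int.cast : ℤ → ℚ)).transpose.row := by
    change LinearIndependent ℚ fun j => (M.map (Int.cast : ℤ → ℚ)).transpose j
    rw [hMQ]
    exact hbli.comp _ eqv.symm.injective
  have hunit : IsUnit (M.map (Int.cast : ℤ → ℚ)).transpose :=
    Matrix.linearIndependent_rows_iff_isUnit.1 hli
  have hdet : M.det ≠ 0 := by
    intro h
    have h2 : (M.map (Int.cast : ℤ → ℚ)).transpose.det = 0 := by
      rw [Matrix.det_transpose]
      change ((Int.castRingHom ℚ).mapMatrix M).det = 0
      rw [← RingHom.map_det, h, map_zero]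
    exact (Matrix.isUnit_iff_isUnit_det _ |>.1 hunit).ne_zero h2
  refine ⟨M.det.natAbs, Int.natAbs_pos.2 hdet, fun N c e hrel l => ?_⟩
  -- restrict the relation to the chosen columns: `Mᵀ e = N c'`
  have hMv : M.transpose.mulVec e = fun j => N * c (idx (eqv.symm j)) := by
    funext j
    have := congrFun hrel (idx (eqv.symm j))
    rw [Pi.smul_apply, Finset.sum_apply, smul_eq_mul] at this
    rw [this]
    change (∑ l, M.transpose j l * e l) = ∑ l, (e l • w l) (idx (eqv.symm j))
    refine Finset.sum_congr rfl fun l' _ => ?_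
    rw [Matrix.transpose_apply, Pi.smul_apply, smul_eq_mul, mul_comm]
  have hadj : M.transpose.det • e = M.transpose.adjugate.mulVec (M.transpose.mulVec e) := by
    rw [Matrix.mulVec_mulVec, Matrix.adjugate_mul, Matrix.smul_mulVec, Matrix.one_mulVec]
  have hl := congrFun hadj l
  rw [hMv, Matrix.det_transpose] at hl
  simp only [Pi.smul_apply, smul_eq_mul, Matrix.mulVec, dotProduct] at hl
  have hdvd : N ∣ M.det * e l := by
    rw [hl]
    refine Finset.dvd_sum fun j _ => ?_
    exact Dvd.intro (M.transpose.adjugate l j * c (idx (eqv.symm j))) (by ring)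
  rcases Int.natAbs_eq M.det with h | h
  · rw [← h]; exact hdvd
  · rw [show (M.det.natAbs : ℤ) = -M.det by omega, neg_mul]
    exact (dvd_neg).2 hdvd

/-! ### Number fields: `S`-units -/

variable {K : Type*} [Field K] [NumberField K]

/-- A torsion element of `ℤₘ₀ = WithZero (Multiplicative ℤ)`-valued valuations: if `xᵏ = 1` with
`k ≠ 0` for `x : Multiplicative ℤ` then `x = 1`. [folklore] -/
theorem eq_one_of_pow_eq_one_multiplicative {x : Multiplicative ℤ} {k : ℕ} (hk : k ≠ 0)
    (h : x ^ k = 1) : x = 1 := by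
  have : k • Multiplicative.toAdd x = 0 := by
    rw [← toAdd_pow, h, toAdd_one]
  have hx : Multiplicative.toAdd x = 0 := (smul_eq_zero.1 this).resolve_left hk
  exact toAdd_eq_zero.1 hx

/-- A unit of finite order has valuation `1` at every finite place. [folklore] -/
theorem valuation_eq_one_of_isOfFinOrder (v : HeightOneSpectrum (𝓞 K)) {ζ : Kˣ}
    (hζ : IsOfFinOrder ζ) : v.valuation K (ζ : K) = 1 := by
  obtain ⟨k, hk, hζk⟩ := hζ.exists_pow_eq_one
  have h1 : v.valuationOfNeZero ζ ^ k = 1 := by rw [← map_pow, hζk, map_one]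
  have h2 := eq_one_of_pow_eq_one_multiplicative hk.ne' h1
  rw [← valuationOfNeZero_eq, h2]
  rfl

/-- The finite set of places in the support of finitely many units. [folklore] -/
theorem finite_setOf_exists_valuation_ne_one {t : ℕ} (v : Fin t → Kˣ) :
    {𝔭 : HeightOneSpectrum (𝓞 K) | ∃ l, 𝔭.valuation K (v l : K) ≠ 1}.Finite := by
  have hsub : {𝔭 : HeightOneSpectrum (𝓞 K) | ∃ l, 𝔭.valuation K (v l : K) ≠ 1} ⊆
      ⋃ l, (HeightOneSpectrum.Support (𝓞 K) (v l : K) ∪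
        HeightOneSpectrum.Support (𝓞 K) (((v l)⁻¹ : Kˣ) : K)) := by
    intro 𝔭 h𝔭
    obtain ⟨l, hl⟩ := h𝔭
    rw [Set.mem_iUnion]
    refine ⟨l, ?_⟩
    rcases lt_or_gt_of_ne hl with h | h
    · right
      change 1 < 𝔭.valuation K (((v l)⁻¹ : Kˣ) : K)
      rw [Units.val_inv_eq_inv_val, map_inv₀]
      exact one_lt_inv_iff₀.2 ⟨(Valuation.pos_iff _).2 (v l).ne_zero, h⟩
    · left
      exact h
  refine Set.Finite.subset ?_ hsub
  exact Set.finite_iUnion fun l =>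
    (HeightOneSpectrum.Support.finite (𝓞 K) _).union (HeightOneSpectrum.Support.finite (𝓞 K) _)

open Literature.NumberTheory.DiophantineGeometry
open Literature.NumberTheory.DiophantineGeometry.NumberField

/-- **Radicals of a finitely generated subgroup of a number field have bounded denominators**
(Zilber 2006, §2; Bays–Zilber 2011, Prop. 2.5, first case — via Dirichlet's `S`-unit theorem):
if `v₁, …, v_t ∈ kˣ` are multiplicatively independent modulo roots of unity then there is `m ≥ 1`
with: `gᴺ = ζ ∏ vₗ^{eₗ}` (`g ∈ kˣ`, `ζ` of finite order) implies `N ∣ m eₗ` for all `l`.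
[cite: BaysZilber2011Covers, Prop. 2.5 and Lemma 5.1] -/
theorem exists_dvd_of_pow_eq_prod_zpow {t : ℕ} (v : Fin t → Kˣ)
    (hind : ∀ e : Fin t → ℤ, IsOfFinOrder (∏ l, v l ^ e l) → e = 0) :
    ∃ m : ℕ, 0 < m ∧ ∀ (g : Kˣ) (N : ℕ) (e : Fin t → ℤ) (ζ : Kˣ), IsOfFinOrder ζ →
      g ^ N = (∏ l, v l ^ e l) * ζ → ∀ l, (N : ℤ) ∣ m * e l := by
  classical
  -- the finite set `S` of places in the support of the `vₗ`
  set S : Set (HeightOneSpectrum (𝓞 K)) :=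
    {𝔭 | ∃ l, 𝔭.valuation K (v l : K) ≠ 1} with hS
  haveI : Finite S := (finite_setOf_exists_valuation_ne_one v).to_subtype
  have hvS : ∀ l, v l ∈ S.unit K := fun l 𝔭 h𝔭 => by
    by_contra h
    exact h𝔭 ⟨l, h⟩
  set V : Fin t → S.unit K := fun l => ⟨v l, hvS l⟩ with hV
  -- coordinates modulo torsion
  set ρ := Units.rank K + Nat.card S with hρ
  let B := sUnitBasisModTorsion S (K := K)
  let π : S.unit K →* Multiplicative (Additive (S.unit K ⧸ CommGroup.torsion (S.unit K))) :=
    (QuotientGroup.mk' (CommGroup.torsion (S.unit K)))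
  let crd : S.unit K → Fin ρ → ℤ := fun x => B.repr (Additive.ofMul (QuotientGroup.mk x))
  have crd_mul : ∀ x y, crd (x * y) = crd x + crd y := fun x y => by
    change (B.repr (Additive.ofMul (QuotientGroup.mk (x * y))) : Fin ρ → ℤ) = _
    rw [QuotientGroup.mk_mul, ofMul_mul, map_add]
    rfl
  have crd_one : crd 1 = 0 := by
    change (B.repr (Additive.ofMul (QuotientGroup.mk (1 : S.unit K))) : Fin ρ → ℤ) = 0
    rw [QuotientGroup.mk_one, ofMul_one, map_zero]
    rfl
  have crd_pow : ∀ (x) (n : ℕ), crd (x ^ n) = n • crd x := fun x n => by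
    induction n with
    | zero => rw [pow_zero, crd_one, zero_smul]
    | succ n ih => rw [pow_succ, crd_mul, ih, succ_nsmul]
  have crd_zpow : ∀ (x) (n : ℤ), crd (x ^ n) = n • crd x := fun x n => by
    change (B.repr (Additive.ofMul (QuotientGroup.mk (x ^ n))) : Fin ρ → ℤ) = _
    rw [QuotientGroup.mk_zpow, ofMul_zpow, map_zsmul]
    rfl
  have crd_prod : ∀ e : Fin t → ℤ, crd (∏ l, V l ^ e l) = ∑ l, e l • crd (V l) := by
    intro e
    have : ∀ s : Finset (Fin t), crd (∏ l ∈ s, V l ^ e l) = ∑ l ∈ s, e l • crd (V l) := by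
      intro s
      induction s using Finset.induction_on with
      | empty => rw [Finset.prod_empty, Finset.sum_empty, crd_one]
      | insert a s ha ih => rw [Finset.prod_insert ha, Finset.sum_insert ha, crd_mul, crd_zpow, ih]
    exact this Finset.univ
  have crd_torsion : ∀ x : S.unit K, IsOfFinOrder x → crd x = 0 := fun x hx => by
    change (B.repr (Additive.ofMul (QuotientGroup.mk x)) : Fin ρ → ℤ) = 0
    have : (QuotientGroup.mk x : S.unit K ⧸ CommGroup.torsion (S.unit K)) = 1 := by
      rw [QuotientGroup.eq_one_iff]
      exact hx
    rw [this, ofMul_one, map_zero]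
    rfl
  have crd_eq_zero : ∀ x : S.unit K, crd x = 0 → IsOfFinOrder x := fun x hx => by
    have h1 : B.repr (Additive.ofMul (QuotientGroup.mk x)) = 0 := by
      ext i
      exact congrFun hx i
    have h2 : Additive.ofMul (QuotientGroup.mk x : S.unit K ⧸ CommGroup.torsion (S.unit K)) = 0 :=
      B.repr.injective (by rw [h1, map_zero])
    have h3 : (QuotientGroup.mk x : S.unit K ⧸ CommGroup.torsion (S.unit K)) = 1 := h2
    rw [QuotientGroup.eq_one_iff] at h3
    exact h3
  -- finite order passes between `S.unit K` and `Kˣ`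
  have finord_iff : ∀ x : S.unit K, IsOfFinOrder x ↔ IsOfFinOrder (x : Kˣ) := fun x => by
    constructor
    · intro h
      exact (S.unit K).subtype.isOfFinOrder h
    · intro h
      obtain ⟨k, hk, hxk⟩ := h.exists_pow_eq_one
      rw [isOfFinOrder_iff_pow_eq_one]
      exact ⟨k, hk, Subtype.ext (by simpa using hxk)⟩
  -- the integer vectors `wₗ = crd Vₗ` are linearly independent
  set w : Fin t → Fin ρ → ℤ := fun l => crd (V l) with hw
  have hwli : LinearIndependent ℤ w := by
    rw [Fintype.linearIndependent_iff]
    intro a ha l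
    have h1 : crd (∏ l, V l ^ a l) = 0 := by rw [crd_prod]; exact ha
    have h2 : IsOfFinOrder (∏ l, V l ^ a l) := crd_eq_zero _ h1
    have h3 : IsOfFinOrder (∏ l, v l ^ a l) := by
      have := (finord_iff _).1 h2
      convert this using 1
      rw [Subgroup.val_finsetProd]
      simp [hV]
    exact congrFun (hind a h3) l
  obtain ⟨m, hm, hdvd⟩ := exists_dvd_of_linearIndependent w hwli
  refine ⟨m, hm, fun g N e ζ hζ hrel l => ?_⟩
  -- the case `N = 0`: then `∏ vₗ^{eₗ}` is torsion, so `e = 0`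
  rcases Nat.eq_zero_or_pos N with hN | hN
  · subst hN
    have h1 : (∏ l, v l ^ e l) = ζ⁻¹ := by
      rw [pow_zero] at hrel
      exact eq_inv_of_mul_eq_one_left hrel.symm
    have h2 : IsOfFinOrder (∏ l, v l ^ e l) := by rw [h1]; exact hζ.inv
    rw [hind e h2]
    simp
  -- `g` is an `S`-unit
  have hgS : g ∈ S.unit K := fun 𝔭 h𝔭 => by
    have hv1 : ∀ l, 𝔭.valuation K (v l : K) = 1 := fun l => by
      by_contra h; exact h𝔭 ⟨l, h⟩
    have h1 : 𝔭.valuation K ((g ^ N : Kˣ) : K) = 1 := by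
      rw [hrel, Units.val_mul, map_mul, valuation_eq_one_of_isOfFinOrder 𝔭 hζ, mul_one,
        Units.coe_prod, map_prod]
      refine Finset.prod_eq_one fun l _ => ?_
      rw [Units.val_zpow_eq_zpow_val, map_zpow₀, hv1 l, one_zpow]
    rw [Units.val_pow_eq_pow_val, map_pow] at h1
    have h2 : 𝔭.valuationOfNeZero g ^ N = 1 := by
      apply WithZero.coe_injective
      push_cast
      rw [valuationOfNeZero_eq]
      exact h1
    have h3 := eq_one_of_pow_eq_one_multiplicative hN.ne' h2
    rw [← valuationOfNeZero_eq, h3]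
    rfl
  have hζS : ζ ∈ S.unit K := fun 𝔭 _ => valuation_eq_one_of_isOfFinOrder 𝔭 hζ
  set G : S.unit K := ⟨g, hgS⟩ with hG
  set Z : S.unit K := ⟨ζ, hζS⟩ with hZ
  have hrelS : G ^ N = (∏ l, V l ^ e l) * Z := by
    apply Subtype.ext
    rw [Subgroup.coe_mul, Subgroup.coe_pow, Subgroup.val_finsetProd]
    simp only [hG, hV, hZ, Subgroup.coe_zpow]
    exact hrel
  have hZfin : IsOfFinOrder Z := (finord_iff Z).2 hζ
  have hcrd : (N : ℤ) • crd G = ∑ l, e l • w l := by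
    have := congrArg crd hrelS
    rw [crd_pow, crd_mul, crd_torsion Z hZfin, add_zero, crd_prod] at this
    rw [← this, natCast_zsmul]
  exact hdvd N (crd G) e hcrd l

end RadicalLattice

end Literature.FieldTheory.Kummer
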